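import Literature.MathematicalPhysics.KineticTheory.HardSphereEulerLLN

/-!
# `LocalGibbsFineScale` (route `BoxDissipativeWeakStrong`), file C: the conditioned product law,
kernel averages, Cauchy–Schwarz

Support lemmas for item stmt-AtomisticToContinuum-9905 (generic, independent of the cluster-expansion
chain): the canonical `N+1`-particle hard-sphere gas of a density profile `P` written as the conditioned
product law `Ξ⁻¹ · μ^{⊗(N+1)}|_{hard core}` (cf. `posGibbsMeasure_eq`) —

* `integral_cgibbs_eq`, `isProbabilityMeasure_cgibbs`: `∫ F d(Ξ⁻¹μ^{⊗}|hc) = Ξ⁻¹ ∫ F 𝟙[hc] dμ^{⊗}`, a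
  probability measure at small density;
* `measurable_avg`, `avg_nonneg`, `abs_avg_le`, `integral_avg_mul_efR_div`: the empirical average
  `(N+1)⁻¹∑ᵢ g(qᵢ)` and its expectation `E_{N+1}[g(q₀)]` (exchangeability);
* `sq_integral_abs_le_of_memLp`, `integral_abs_le_sqrt_of_memLp`, `integral_abs_le_sqrt`:
  `(E|X|)² ≤ E X²` on a probability space (`Var |X| ≥ 0`).
-/

noncomputable section

namespace Summit.AtomisticToContinuum.HydrodynamicLimit.Theorems
namespace LGFS
open MeasureTheory ProbabilityTheory Finset Filter Topology Metric
open Literature.Probability.LatticeModels Literature.MathematicalPhysics.StatisticalMechanics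
  Literature.MathematicalPhysics.KineticTheory
open scoped ENNReal

variable {P : DensityProfile} {σ : ℝ}

/-! ### The conditioned product law -/

/-- Restricting to the hard-core set is multiplying by its indicator `efR`. -/
theorem setIntegral_hardCore_eq {ε : ℝ} {n : ℕ} (F : (Fin n → T3) → ℝ) :
    ∫ q in hardCoreSet (Ov ε) (univ : Finset (Fin n)), F q ∂Measure.pi (fun _ : Fin n => P.μ) =
      ∫ q, F q * efR (Ov ε) q univ ∂Measure.pi (fun _ : Fin n => P.μ) := by
  rw [← integral_indicator (measurableSet_hardCoreSet (measurableSet_ov ε) _)]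
  refine integral_congr_ae (ae_of_all _ fun q => ?_)
  dsimp only
  rw [efR_eq_indicator]
  by_cases hq : q ∈ hardCoreSet (Ov ε) (univ : Finset (Fin n))
  · rw [Set.indicator_of_mem hq, Set.indicator_of_mem hq, Pi.one_apply, mul_one]
  · rw [Set.indicator_of_notMem hq, Set.indicator_of_notMem hq, mul_zero]

/-- **Integration against the conditioned product law**: `∫ F d(Ξ⁻¹ μ^{⊗}|_{hc}) = Ξ⁻¹ ∫ F 𝟙[hc] dμ^{⊗}`
(for `Ξ ≥ 0`). -/
theorem integral_cgibbs_eq {ε : ℝ} {n : ℕ} {Z : ℝ} (hZ : 0 ≤ Z) (F : (Fin n → T3) → ℝ) :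
    ∫ q, F q ∂(ENNReal.ofReal Z⁻¹ •
        (Measure.pi fun _ : Fin n => P.μ).restrict (hardCoreSet (Ov ε) (univ : Finset (Fin n)))) =
      Z⁻¹ * ∫ q, F q * efR (Ov ε) q univ ∂Measure.pi (fun _ : Fin n => P.μ) := by
  rw [integral_smul_measure, setIntegral_hardCore_eq, ENNReal.toReal_ofReal (inv_nonneg.2 hZ), smul_eq_mul]

/-- **The conditioned product law is a probability measure** (small density, `Ξ_N(N+1) > 0`). -/
theorem isProbabilityMeasure_cgibbs (hs : SmallDensity P σ) (N : ℕ) :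
    IsProbabilityMeasure (ENNReal.ofReal (XiN P σ N (N + 1))⁻¹ •
      (Measure.pi fun _ : Fin (N + 1) => P.μ).restrict
        (hardCoreSet (Ov (hsDiameter σ N)) (univ : Finset (Fin (N + 1))))) := by
  have hXi := XiN_pos hs.σ_pos.le hs.σ_lt_half hs.ovDensity_lt_one (N := N) (m := N + 1) le_rfl
  refine ⟨?_⟩
  rw [Measure.smul_apply, Measure.restrict_apply_univ, smul_eq_mul]
  have hm : (Measure.pi fun _ : Fin (N + 1) => P.μ) (hardCoreSet (Ov (hsDiameter σ N))
      (univ : Finset (Fin (N + 1)))) = ENNReal.ofReal (XiN P σ N (N + 1)) := by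
    rw [XiN, Xi, firstLabels_self, hcProb, ofReal_measureReal]
  rw [hm, ← ENNReal.ofReal_mul (inv_nonneg.2 hXi.le), inv_mul_cancel₀ hXi.ne', ENNReal.ofReal_one]

/-! ### The kernel average: measurability, bounds, expectation -/

section Average

variable {g : T3 → ℝ} {C : ℝ} {n : ℕ}

/-- The empirical average `q ↦ n⁻¹ ∑ᵢ g(qᵢ)` is measurable. -/
theorem measurable_avg (hg : Measurable g) :
    Measurable fun q : Fin n → T3 => ((n : ℝ))⁻¹ * ∑ i, g (q i) :=
  measurable_const.mul (Finset.measurable_sum _ fun i _ => hg.comp (measurable_pi_apply i))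

/-- `0 ≤ n⁻¹ ∑ᵢ g(qᵢ)` for `g ≥ 0`. -/
theorem avg_nonneg (hg0 : ∀ y, 0 ≤ g y) (q : Fin n → T3) : 0 ≤ ((n : ℝ))⁻¹ * ∑ i, g (q i) :=
  mul_nonneg (inv_nonneg.2 (Nat.cast_nonneg _)) (sum_nonneg fun _ _ => hg0 _)

/-- `|n⁻¹ ∑ᵢ g(qᵢ)| ≤ C` for `0 ≤ g ≤ C` and `n ≠ 0`. -/
theorem abs_avg_le [NeZero n] (hg0 : ∀ y, 0 ≤ g y) (hgC : ∀ y, g y ≤ C) (q : Fin n → T3) :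
    |((n : ℝ))⁻¹ * ∑ i, g (q i)| ≤ C := by
  rw [abs_of_nonneg (avg_nonneg hg0 q)]
  have hn' : (0 : ℝ) < n := by exact_mod_cast Nat.pos_of_ne_zero (NeZero.ne n)
  rw [inv_mul_le_iff₀ hn']
  calc ∑ i, g (q i) ≤ ∑ _i : Fin n, C := sum_le_sum fun i _ => hgC _
    _ = n * C := by rw [sum_const, card_univ, Fintype.card_fin, nsmul_eq_mul]

end Average

/-- **Expectation of the average (exchangeability)**: `Ξ⁻¹ ∫ (n⁻¹ ∑ᵢ g(qᵢ)) 𝟙[hc] dμ^{⊗(N+1)} = E_{N+1}[g(q₀)]`. -/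
theorem integral_avg_mul_efR_div {g : T3 → ℝ} (hg : Measurable g) {C : ℝ} (hgC : ∀ y, |g y| ≤ C) (N : ℕ) :
    (∫ q, ((((N + 1 : ℕ) : ℝ))⁻¹ * ∑ i, g (q i)) * efR (Ov (hsDiameter σ N)) q univ
        ∂Measure.pi (fun _ : Fin (N + 1) => P.μ)) / XiN P σ N (N + 1) = onePt P σ g N 0 := by
  have hterm : ∀ i : Fin (N + 1), ∫ q, g (q i) * efR (Ov (hsDiameter σ N)) q univ
      ∂Measure.pi (fun _ : Fin (N + 1) => P.μ) = Md P (hsDiameter σ N) (N + 1) g (N + 1) :=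
    fun j => integral_mul_efR_eq_Md P _ hg j
  have hint : ∀ i : Fin (N + 1), Integrable (fun q : Fin (N + 1) → T3 => g (q i) * efR (Ov (hsDiameter σ N)) q univ)
      (Measure.pi fun _ : Fin (N + 1) => P.μ) := fun i =>
    integrable_mul_efR P _ (hg.comp (measurable_pi_apply i)) fun q => hgC (q i)
  have h1 : ∫ q, ((((N + 1 : ℕ) : ℝ))⁻¹ * ∑ i, g (q i)) * efR (Ov (hsDiameter σ N)) q univ
      ∂Measure.pi (fun _ : Fin (N + 1) => P.μ) = Md P (hsDiameter σ N) (N + 1) g (N + 1) := by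
    have hre : ∀ q : Fin (N + 1) → T3, ((((N + 1 : ℕ) : ℝ))⁻¹ * ∑ i, g (q i)) * efR (Ov (hsDiameter σ N)) q univ =
        (((N + 1 : ℕ) : ℝ))⁻¹ * ∑ i, g (q i) * efR (Ov (hsDiameter σ N)) q univ := fun q => by
      rw [mul_assoc, sum_mul]
    simp_rw [hre]
    rw [integral_const_mul, integral_finsetSum _ fun i _ => hint i]
    simp_rw [hterm]
    rw [sum_const, card_univ, Fintype.card_fin, nsmul_eq_mul, ← mul_assoc,
      inv_mul_cancel₀ (by positivity), one_mul]
  rw [h1, onePt, XiN]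
  rfl

/-! ### Cauchy–Schwarz on a probability space -/

/-- `(∫ |f|)² ≤ ∫ f²` on a probability space, for `f ∈ L²` (`Var |f| ≥ 0`). -/
theorem sq_integral_abs_le_of_memLp {Ω : Type*} [MeasurableSpace Ω] {μ : Measure Ω}
    [IsProbabilityMeasure μ] {f : Ω → ℝ} (hf : MemLp f 2 μ) :
    (∫ ω, |f ω| ∂μ) ^ 2 ≤ ∫ ω, f ω ^ 2 ∂μ := by
  have hmem : MemLp (fun ω => |f ω|) 2 μ := hf.abs
  have hv := variance_nonneg (fun ω => |f ω|) μ
  rw [variance_eq_sub hmem] at hv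
  simp only [Pi.pow_apply, sq_abs] at hv
  linarith

/-- `∫ |f| ≤ √(∫ f²)` on a probability space, for `f ∈ L²`. -/
theorem integral_abs_le_sqrt_of_memLp {Ω : Type*} [MeasurableSpace Ω] {μ : Measure Ω}
    [IsProbabilityMeasure μ] {f : Ω → ℝ} (hf : MemLp f 2 μ) :
    ∫ ω, |f ω| ∂μ ≤ Real.sqrt (∫ ω, f ω ^ 2 ∂μ) := by
  have h := Real.abs_le_sqrt (sq_integral_abs_le_of_memLp hf)
  rwa [abs_of_nonneg (integral_nonneg fun ω => abs_nonneg _)] at h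

/-- `∫ |f| ≤ √(∫ f²)` on a probability space, for `f` bounded measurable. -/
theorem integral_abs_le_sqrt {Ω : Type*} [MeasurableSpace Ω] {μ : Measure Ω} [IsProbabilityMeasure μ]
    {f : Ω → ℝ} (hf : Measurable f) {B : ℝ} (hB : ∀ ω, |f ω| ≤ B) :
    ∫ ω, |f ω| ∂μ ≤ Real.sqrt (∫ ω, f ω ^ 2 ∂μ) :=
  integral_abs_le_sqrt_of_memLp (memLp_of_bounded (a := -B) (b := B)
    (ae_of_all _ fun ω => ⟨by linarith [neg_abs_le (f ω), hB ω], (le_abs_self _).trans (hB ω)⟩)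
    hf.aestronglyMeasurable 2)

end LGFS
end Summit.AtomisticToContinuum.HydrodynamicLimit.Theorems
end
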